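import Mathlib.MeasureTheory.Function.AEEqOfIntegral
import Mathlib.MeasureTheory.Integral.Bochner.Set
import Mathlib.MeasureTheory.Constructions.BorelSpace.Basic
import Mathlib.Topology.Algebra.Nonarchimedean.Basic
import Mathlib.Topology.Algebra.OpenSubgroup
import Mathlib.Order.Disjointed
import HarnessLib

/-!
# Densities on totally disconnected locally compact spaces: compact-open bases, countable clopen partitions subordinate to a cover,
# and a.e. uniqueness of a density from its integrals over compact open sets

Topic `MeasureTheory/Function`; namespace `Literature.MeasureTheory.Function`.  THEOREMS ONLY (Mathlib only; no definition, no instance, no notation,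
no named fact, no `sorry`).  The three elementary facts of «test-function calculus» on a locally compact totally disconnected space that the
patching of local integrable representatives of an invariant distribution (Harish-Chandra's characters, [HarishChandra1999, §21 p. 87; Thm. 16.3])
needs and Mathlib does not state in this form:

* §1 (locally compact NON-ARCHIMEDEAN groups) `exists_isCompact_isOpen_mem_subset` — every neighbourhood of a point contains a COMPACT OPEN
  neighbourhood (a coset `g·V` of a compact open subgroup, van Dantzig); `isTopologicalBasis_setOf_isCompact_isOpen` — the compact open sets form a
  basis [BernsteinZelevinsky1976, §1.1].
* §2 `exists_compactOpen_partition_subordinate` — in such a group which is moreover second countable and Hausdorff, every pointed open cover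
  `(O_g ∋ g)_g` admits a COUNTABLE PARTITION of the group into pairwise disjoint compact open sets `W_n`, each inside some `O_{γ_n}` (Lindelöf +
  `disjointed`) [BernsteinZelevinsky1976, §1.3 (partitions of `l`-spaces)].
* §3 (any second countable Hausdorff Borel space with a basis of compact open sets) **`ae_eq_restrict_of_forall_setIntegral_eq_of_isCompact_isOpen`**
  — two functions integrable on the compact open subsets of an open set `Ω` and with the same integral over each of them agree a.e. on `Ω`
  (Dynkin's π–λ theorem on the π-system of compact open sets, which generates the Borel σ-algebra, inside each compact open `C₀ ⊆ Ω`; then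
  `Ω` is a countable union of such `C₀`).  This is the uniqueness half of «a distribution given by a locally integrable function determines the
  function almost everywhere» for the test functions `𝟙_C`, `C` compact open [HarishChandra1970, Part I §2].

## References
* [BernsteinZelevinsky1976] I. N. Bernstein, A. V. Zelevinsky, *Representations of the group GL(n, F) where F is a non-archimedean local field*,
  Russian Math. Surveys 31:3 (1976), §1.1–§1.3 (`l`-spaces and `l`-groups: compact open bases, partitions, distributions).
* [HarishChandra1970] Harish-Chandra (notes by G. van Dijk), *Harmonic Analysis on Reductive p-adic Groups*, LNM 162 (1970), Part I §2.
* [HarishChandra1999] Harish-Chandra, *Admissible Invariant Distributions on Reductive p-adic Groups*, AMS ULS 16 (1999), §21 p. 87, Thm. 16.3.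
-/

set_option autoImplicit false

open MeasureTheory TopologicalSpace Set Filter
open scoped Topology ENNReal Function

namespace Literature.MeasureTheory.Function

/-! ## §1 Compact open neighbourhoods in a locally compact non-archimedean group -/

section Nonarchimedean

variable {G : Type*} [Group G] [TopologicalSpace G] [NonarchimedeanGroup G] [LocallyCompactSpace G]

/-- **Every open neighbourhood of `g` contains a compact open neighbourhood of `g`** (a coset `g·V` of a compact open subgroup `V`: an open
subgroup inside a compact neighbourhood of `1` is closed, hence compact). [cite: BernsteinZelevinsky1976, §1.1] -/
theorem exists_isCompact_isOpen_mem_subset {O : Set G} (hO : IsOpen O) {g : G} (hg : g ∈ O) :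
    ∃ C : Set G, IsCompact C ∧ IsOpen C ∧ g ∈ C ∧ C ⊆ O := by
  obtain ⟨N, hNc, hN1⟩ := exists_compact_mem_nhds (1 : G)
  have hO' : (fun w => g * w) ⁻¹' O ∈ 𝓝 (1 : G) :=
    (continuous_const_mul g).continuousAt.preimage_mem_nhds (by simpa only [mul_one] using hO.mem_nhds hg)
  obtain ⟨V, hV⟩ := NonarchimedeanGroup.is_nonarchimedean _ (Filter.inter_mem hN1 hO')
  have hVc : IsCompact (V : Set G) := hNc.of_isClosed_subset V.isClosed fun w hw => (hV hw).1
  refine ⟨(fun w => g * w) '' (V : Set G), hVc.image (continuous_const_mul g), (isOpenMap_mul_left g) _ V.isOpen,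
    ⟨1, V.one_mem, mul_one g⟩, ?_⟩
  rintro _ ⟨w, hw, rfl⟩
  exact (hV hw).2

/-- **The compact open sets form a basis of the topology** of a locally compact non-archimedean group. [cite: BernsteinZelevinsky1976, §1.1] -/
theorem isTopologicalBasis_setOf_isCompact_isOpen : IsTopologicalBasis {C : Set G | IsCompact C ∧ IsOpen C} :=
  isTopologicalBasis_of_isOpen_of_nhds (fun _ hC => hC.2) fun g O hg hO => by
    obtain ⟨C, hCc, hCo, hgC, hCO⟩ := exists_isCompact_isOpen_mem_subset hO hg
    exact ⟨C, ⟨hCc, hCo⟩, hgC, hCO⟩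

/-! ## §2 Countable compact-open partitions subordinate to a pointed open cover -/

/-- **Countable partition into compact open sets subordinate to a pointed open cover.**  In a second countable Hausdorff locally compact
non-archimedean group, given open sets `O g ∋ g`, there are points `γ n` and pairwise DISJOINT compact open sets `W n ⊆ O (γ n)` covering the
group (countable subcover of the compact open neighbourhoods of §1 by Lindelöf, then `disjointed`; each `W n` is `C n` minus a finite union of
compact — hence closed — sets). [cite: BernsteinZelevinsky1976, §1.3] -/
theorem exists_compactOpen_partition_subordinate [SecondCountableTopology G] [T2Space G] (O : G → Set G) (hO : ∀ g, IsOpen (O g))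
    (hgO : ∀ g, g ∈ O g) :
    ∃ (γ : ℕ → G) (W : ℕ → Set G), (∀ n, IsCompact (W n)) ∧ (∀ n, IsOpen (W n)) ∧ Pairwise (Disjoint on W) ∧
      (∀ n, W n ⊆ O (γ n)) ∧ ∀ z, ∃ n, z ∈ W n := by
  choose C hCc hCo hgC hCO using fun g => exists_isCompact_isOpen_mem_subset (hO g) (hgO g)
  obtain ⟨s, hsc, hsU⟩ := TopologicalSpace.countable_cover_nhds (f := C) fun g => (hCo g).mem_nhds (hgC g)
  have hsne : s.Nonempty := by
    by_contra h
    rw [Set.not_nonempty_iff_eq_empty] at h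
    have h1 : (1 : G) ∈ ⋃ x ∈ s, C x := by rw [hsU]; trivial
    rw [h] at h1
    simp only [mem_empty_iff_false, iUnion_of_empty, iUnion_empty] at h1
  obtain ⟨γ, hγ⟩ := hsc.exists_eq_range hsne
  refine ⟨γ, disjointed (fun n => C (γ n)), fun n => ?_, fun n => ?_, disjoint_disjointed _,
    fun n => (disjointed_subset _ n).trans (hCO _), fun z => ?_⟩
  · rw [disjointed_eq_inter_compl]
    exact (hCc _).inter_right (isClosed_biInter fun j _ => (hCo (γ j)).isClosed_compl)
  · rw [disjointed_eq_inter_compl]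
    exact (hCo _).inter ((Set.finite_Iio n).isOpen_biInter fun j _ => (hCc (γ j)).isClosed.isOpen_compl)
  · have hz : z ∈ ⋃ x ∈ s, C x := by rw [hsU]; trivial
    rw [hγ] at hz
    obtain ⟨n, hn⟩ : ∃ n, z ∈ C (γ n) := by simpa only [mem_iUnion, mem_range, exists_prop, exists_exists_eq_and] using hz
    have hz' : z ∈ ⋃ n, disjointed (fun n => C (γ n)) n := by
      rw [iUnion_disjointed]
      exact mem_iUnion.2 ⟨n, hn⟩
    exact mem_iUnion.1 hz'

end Nonarchimedean

/-! ## §3 A density is determined a.e. by its integrals over compact open sets -/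

section AEEq

variable {X : Type*} [TopologicalSpace X] [MeasurableSpace X] [BorelSpace X] [SecondCountableTopology X] [T2Space X]
  {E : Type*} [NormedAddCommGroup E] [NormedSpace ℝ E] [CompleteSpace E]

/-- On a compact open `C₀`: two functions integrable on `C₀` with equal integrals over every compact open `C ⊆ C₀` agree a.e. on `C₀`
(π–λ: the compact open sets are a π-system generating the Borel σ-algebra when they form a basis; the sets `s` with `∫_{s ∩ C₀} f = ∫_{s ∩ C₀} g`
form a Dynkin system). [cite: HarishChandra1970, Part I §2] [cite: BernsteinZelevinsky1976, §1.3] -/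
theorem ae_eq_restrict_of_forall_setIntegral_eq_of_subset (hB : IsTopologicalBasis {C : Set X | IsCompact C ∧ IsOpen C}) (μ : Measure X)
    {C₀ : Set X} (hC₀c : IsCompact C₀) (hC₀o : IsOpen C₀) {f g : X → E} (hf : IntegrableOn f C₀ μ) (hg : IntegrableOn g C₀ μ)
    (h : ∀ C ⊆ C₀, IsCompact C → IsOpen C → ∫ x in C, f x ∂μ = ∫ x in C, g x ∂μ) :
    f =ᵐ[μ.restrict C₀] g := by
  -- `∫_{s ∩ C₀} f = ∫_{s ∩ C₀} g` for every measurable `s`, by induction over the generating π-system of compact open sets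
  have h_eq : ‹MeasurableSpace X› = MeasurableSpace.generateFrom {C : Set X | IsCompact C ∧ IsOpen C} :=
    (BorelSpace.measurable_eq (α := X)).trans hB.borel_eq_generateFrom
  have h_inter : IsPiSystem {C : Set X | IsCompact C ∧ IsOpen C} :=
    fun C hC D hD _ => ⟨hC.1.inter_right hD.1.isClosed, hC.2.inter hD.2⟩
  have key : ∀ s : Set X, MeasurableSet s → ∫ x in s ∩ C₀, f x ∂μ = ∫ x in s ∩ C₀, g x ∂μ := by
    intro s hs
    induction s, hs using MeasurableSpace.induction_on_inter h_eq h_inter with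
    | empty => simp only [empty_inter, Measure.restrict_empty, integral_zero_measure]
    | basic t ht => exact h _ inter_subset_right (ht.1.inter_right hC₀c.isClosed) (ht.2.inter hC₀o)
    | compl t htm ih =>
        have hft := integral_inter_add_sdiff htm hf
        have hgt := integral_inter_add_sdiff htm hg
        have htot := h C₀ Subset.rfl hC₀c hC₀o
        rw [inter_comm] at ih
        rw [← sdiff_eq_compl_inter]
        -- `∫_{C₀ \ t} f = ∫_{C₀} f - ∫_{C₀ ∩ t} f`, same for `g`
        have e1 : ∫ x in C₀ \ t, f x ∂μ = ∫ x in C₀, f x ∂μ - ∫ x in C₀ ∩ t, f x ∂μ := by rw [← hft]; abel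
        have e2 : ∫ x in C₀ \ t, g x ∂μ = ∫ x in C₀, g x ∂μ - ∫ x in C₀ ∩ t, g x ∂μ := by rw [← hgt]; abel
        rw [e1, e2, htot, ih]
    | iUnion F hdisj hFm ih =>
        rw [iUnion_inter]
        have hd : Pairwise (Disjoint on fun i => F i ∩ C₀) := fun i j hij =>
          (hdisj hij).mono inter_subset_left inter_subset_left
        have hm : ∀ i, MeasurableSet (F i ∩ C₀) := fun i => (hFm i).inter hC₀o.measurableSet
        have hsub : (⋃ i, F i ∩ C₀) ⊆ C₀ := iUnion_subset fun i => inter_subset_right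
        rw [integral_iUnion hm hd (hf.mono_set hsub), integral_iUnion hm hd (hg.mono_set hsub)]
        exact tsum_congr ih
  refine Integrable.ae_eq_of_forall_setIntegral_eq f g hf hg fun s hs _ => ?_
  rw [Measure.restrict_restrict hs]
  exact key s hs

/-- **A DENSITY IS DETERMINED A.E. BY ITS INTEGRALS OVER COMPACT OPEN SETS.**  Let `X` be a second countable Hausdorff Borel space whose compact open
sets form a basis (e.g. a locally compact non-archimedean group, §1), `Ω ⊆ X` open, and `f, g` integrable on every compact open `C ⊆ Ω` with
`∫_C f = ∫_C g` for all such `C`.  Then `f = g` a.e. on `Ω`.  (Uniqueness of the locally integrable function representing a distribution, tested on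
the indicator functions of compact open sets.) [cite: HarishChandra1970, Part I §2] [cite: BernsteinZelevinsky1976, §1.3] -/
theorem ae_eq_restrict_of_forall_setIntegral_eq_of_isCompact_isOpen (hB : IsTopologicalBasis {C : Set X | IsCompact C ∧ IsOpen C})
    (μ : Measure X) {Ω : Set X} (hΩ : IsOpen Ω) {f g : X → E} (hf : ∀ C ⊆ Ω, IsCompact C → IsOpen C → IntegrableOn f C μ)
    (hg : ∀ C ⊆ Ω, IsCompact C → IsOpen C → IntegrableOn g C μ)
    (h : ∀ C ⊆ Ω, IsCompact C → IsOpen C → ∫ x in C, f x ∂μ = ∫ x in C, g x ∂μ) :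
    f =ᵐ[μ.restrict Ω] g := by
  -- `Ω` is a countable union of compact open sets
  obtain ⟨S, hSB, hΩS⟩ := hB.open_eq_sUnion hΩ
  obtain ⟨T, hTc, hTS, hTU⟩ := TopologicalSpace.isOpen_sUnion_countable S fun s hs => (hSB hs).2
  have hΩT : Ω = ⋃ s ∈ T, s := by rw [← sUnion_eq_biUnion, hTU, hΩS]
  rw [hΩT, ae_eq_restrict_biUnion_iff _ hTc]
  intro C₀ hC₀
  have hC₀ : IsCompact C₀ ∧ IsOpen C₀ := hSB (hTS hC₀)
  have hC₀Ω : C₀ ⊆ Ω := by rw [hΩS]; exact subset_sUnion_of_mem (hTS ‹C₀ ∈ T›)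
  exact ae_eq_restrict_of_forall_setIntegral_eq_of_subset hB μ hC₀.1 hC₀.2 (hf C₀ hC₀Ω hC₀.1 hC₀.2) (hg C₀ hC₀Ω hC₀.1 hC₀.2)
    fun C hC hCc hCo => h C (hC.trans hC₀Ω) hCc hCo

end AEEq

end Literature.MeasureTheory.Function
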